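import Summits.CriticalPhenomena.CardyFormulaZ2.Theorems.CardySusyWardDiscretisationFamilyExistsLegEast
import Summits.CriticalPhenomena.CardyFormulaZ2.Theorems.CardySusyWardDiscretisationFamilyExistsLegStdA
import Summits.CriticalPhenomena.CardyFormulaZ2.Theorems.CardySusyWardDiscretisationFamilyExistsTransportC
import Summits.CriticalPhenomena.CardyFormulaZ2.Theorems.CardySusyWardDiscretisationFamilyExistsTransportD
import HarnessLib

/-!
# The leg in standard position — helper for `DiscretisationFamilyExists` (stmt-CriticalPhenomena-9644)

`legData_std`: bare data `⟨Ω, δ, ∅, ∅⟩` on a regular open set, standard position (an exterior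
point `q` straight below a deep point `p`, both well inside the window).  Then some leg exists,
`∃ p₁, dist p₁ p ≤ 3δ ∧ Nonempty (LegData Ω δ a η p₁)`: the first event of the column west of
`p`'s column is either not I-degenerate — then `legData_east` applies directly — or it is, and
then the reflected domain `z ↦ -z̄` (where that event is II-degenerate, hence not I-degenerate)
carries an east leg, pulled back along the reflection (`nonempty_legData_of_image`).
-/

noncomputable section

open Set Metric Complex
open Literature.Probability.LatticeModels Literature.Probability.Percolation
  Literature.Probability.LatticeModels.Mesh Literature.Probability.LatticeModels.DiscreteDobrushin
  Literature.Topology.PlaneTopology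

namespace Summit.CriticalPhenomena.CardyFormulaZ2.Theorems.DiscretisationFamilyExists

set_option maxHeartbeats 1600000 in
/-- **The leg in standard position.** See the module docstring. [folklore] -/
theorem legData_std {Ω : Set ℂ} {δ : ℝ} (hΩ : IsOpen Ω)
    (hJE : frontier Ω ⊆ closure (closure Ω)ᶜ) (hext : IsConnected (closure Ω)ᶜ)
    (hunb : ¬ Bornology.IsBounded (closure Ω)ᶜ) (hne : (frontier Ω).Nonempty) (hδ : 0 < δ)
    {p q a : ℂ} {η r : ℝ} (hq : ball q r ⊆ (closure Ω)ᶜ) (hr : 4 * δ ≤ r)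
    (hpΩ : ball p (12 * δ) ⊆ Ω)
    (hbulk : ∀ x : Site 2, meshPoint δ x ∈ closedBall p (12 * δ) → x ∈ meshDomain Ω δ)
    (hre : q.re = p.re) (hgap : 7 * δ ≤ p.im - q.im)
    (hwin : closedBall p (dist p q + 16 * δ) ⊆ ball a η) :
    ∃ p₁ : ℂ, dist p₁ p ≤ 3 * δ ∧ Nonempty (LegData Ω δ a η p₁) := by
  -- cells of `p` and `q`
  set c := ⌊p.re / δ⌋ with hcdef
  set R := ⌊p.im / δ⌋ with hRdef
  set j₁ := ⌊q.im / δ⌋ with hj₁def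
  have hc := floor_mesh_bounds hδ p.re
  have hR := floor_mesh_bounds hδ p.im
  have hj₁ := floor_mesh_bounds hδ q.im
  rw [← hcdef] at hc; rw [← hRdef] at hR; rw [← hj₁def] at hj₁
  have hcq : δ * c ≤ q.re ∧ q.re < δ * (c + 1) := by rw [hre]; exact hc
  have hj₁R : j₁ + 5 ≤ R := by
    have : (j₁ : ℝ) + 5 < R + 1 := by
      by_contra h; push Not at h; nlinarith [hj₁.1, hR.2]
    have : j₁ + 5 < R + 1 := by exact_mod_cast this
    omega
  have hpq : p.im - q.im ≤ dist p q := by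
    rw [Complex.dist_eq]; exact le_trans (le_abs_self _) (by simpa using abs_im_le_norm (p - q))
  -- the deep block and the exterior row, in the original domain
  have hdeepΩ : ∀ k j : ℤ, c - 4 ≤ k → k ≤ c + 4 → R - 5 ≤ j → j ≤ R + 1 →
      (⟨Ω, δ, ∅, ∅⟩ : DiscreteDobrushin).IsInnerFace ![k, j] :=
    fun k j h1 h2 h3 h4 => isInnerFace_near hδ hc hR hpΩ hbulk ⟨h1, h2⟩ ⟨h3, h4⟩
  have hbotΩ : ∀ k : ℤ, c - 3 ≤ k → k ≤ c + 1 → ¬ (⟨Ω, δ, ∅, ∅⟩ : DiscreteDobrushin).IsInnerFace ![k, j₁] :=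
    fun k h1 h2 => not_isInnerFace_exterior_row hΩ hJE hext hunb hδ hcq hj₁ hq hr ⟨h1, h2⟩
  -- window bookkeeping: a point with controlled coordinates is in the window
  have hwin' : ∀ z : ℂ, |z.re - p.re| ≤ 8 * δ → δ * (j₁ - 2) ≤ z.im → z.im ≤ δ * (R + 2) → z ∈ ball a η := by
    intro z h1 h2 h3
    apply hwin
    rw [mem_closedBall]
    have him : |z.im - p.im| ≤ dist p q + 3 * δ := by
      rw [abs_le]; constructor <;> nlinarith [hj₁.2, hR.1, hR.2, hpq, dist_nonneg (x := p) (y := q)]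
    exact (dist_le_of_abs_le h1 him).trans (by linarith)
  -- dichotomy on the first event of column `c - 1`
  by_cases H : ∃ e₀ : ℤ, (j₁ ≤ e₀ ∧ e₀ + 5 ≤ R ∧
      (∀ j : ℤ, e₀ < j → j ≤ R → ((⟨Ω, δ, ∅, ∅⟩ : DiscreteDobrushin).IsInnerFace ![c - 1, j] ∧
        ¬ (((![c - 1, j + 1] : Site 2) ∈ (⟨Ω, δ, ∅, ∅⟩ : DiscreteDobrushin).zdBoundary) ∧
          ((![c - 1 + 1, j + 1] : Site 2) ∈ (⟨Ω, δ, ∅, ∅⟩ : DiscreteDobrushin).zdBoundary)))) ∧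
      ¬ ((⟨Ω, δ, ∅, ∅⟩ : DiscreteDobrushin).IsInnerFace ![c - 1, e₀] ∧
        ¬ (((![c - 1, e₀ + 1] : Site 2) ∈ (⟨Ω, δ, ∅, ∅⟩ : DiscreteDobrushin).zdBoundary) ∧
          ((![c - 1 + 1, e₀ + 1] : Site 2) ∈ (⟨Ω, δ, ∅, ∅⟩ : DiscreteDobrushin).zdBoundary))) ∧
      ¬ (⟨Ω, δ, ∅, ∅⟩ : DiscreteDobrushin).IsInnerFace ![c - 1, e₀]) ∧
      δ + infDist (meshPoint δ ![c - 1, e₀ + 1]) (frontier Ω) ≤ infDist (meshPoint δ ![c - 1 + 1, e₀ + 1]) (frontier Ω)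
  · -- Case 2: I-degenerate — reflect
    obtain ⟨e₀, ⟨he₀l, he₀R, hcl, hX, hni⟩, hdegI⟩ := H
    obtain ⟨g, gf, G, π, hG, hcor, hunit, hπ, hGz, hg, hgf⟩ := exists_latticeIso_refl δ
    -- coordinates of `G`
    have hGre : ∀ z : ℂ, (G z).re = -z.re := fun z => by rw [hGz]; simp
    have hGim : ∀ z : ℂ, (G z).im = z.im := fun z => by rw [hGz]; simp
    have hGsymm : ∀ z : ℂ, G.symm z = G z := fun z => by
      apply G.injective; rw [LinearIsometryEquiv.apply_symm_apply, hGz, hGz]; simp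
    have hGcenter : ∀ k j : ℤ, G (cellCenter δ k j) = cellCenter δ (-k - 1) j := fun k j => by
      apply Complex.ext
      · rw [hGre, cellCenter_re, cellCenter_re]; push_cast; ring
      · rw [hGim, cellCenter_im, cellCenter_im]
    -- cells and sites along the reflection
    have hcell : ∀ k j : ℤ, (![k, j] : Site 2) = gf ![-k - 1, j] := fun k j => by
      rw [hgf]; simp
    have hsite : ∀ k j : ℤ, (![k, j] : Site 2) = g ![-k, j] := fun k j => by
      rw [hg]; simp
    have hinner : ∀ k j : ℤ, (⟨G '' Ω, δ, ∅, ∅⟩ : DiscreteDobrushin).IsInnerFace ![k, j] ↔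
        (⟨Ω, δ, ∅, ∅⟩ : DiscreteDobrushin).IsInnerFace ![-k - 1, j] := fun k j => by
      rw [hcell k j]; exact isInnerFace_map_iff hδ hG hcor
    have hbdry : ∀ k j : ℤ, (![k, j] : Site 2) ∈ (⟨G '' Ω, δ, ∅, ∅⟩ : DiscreteDobrushin).zdBoundary ↔
        (![-k, j] : Site 2) ∈ (⟨Ω, δ, ∅, ∅⟩ : DiscreteDobrushin).zdBoundary := fun k j => by
      rw [hsite k j]; exact mem_zdBoundary_map_iff hδ hG hcor
    have hdist : ∀ k j : ℤ, infDist (meshPoint δ ![k, j]) (frontier (G '' Ω)) =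
        infDist (meshPoint δ ![-k, j]) (frontier Ω) := fun k j => by
      rw [hsite k j, hG, infDist_frontier_image]
    -- the east leg in the reflected domain, central column `-c`
    have hL : Nonempty (LegData (G '' Ω) δ (G a) η (G (cellCenter δ (c - 2) R))) := by
      refine legData_east (j₀ := -c) (isOpenMap_image G) (frontier_image_subset G hJE)
        (isConnected_compl_closure_image G hext) (not_isBounded_compl_closure_image G hunb)
        hδ (frontier_image_nonempty G hne) hj₁R ?_ ?_ ?_ ?_ ?_
      · intro k j h1 h2 h3 h4
        rw [hinner]; exact hdeepΩ _ _ (by omega) (by omega) h3 h4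
      · intro k h1 h2
        rw [hinner]; exact hbotΩ _ (by omega) (by omega)
      · -- the first event of column `-c` is that of column `c-1`, and it is II-degenerate
        intro e h1 h2 h3 h4 h5 hdeg
        simp only [hinner, hbdry, hdist, show -(-c) = c by ring,
          show -(-c + 1) = c - 1 by ring] at h3 h4 h5 hdeg
        have hee : e = e₀ := by
          refine event_unique (R := R) (by omega) (by omega) (C := fun j =>
            (⟨Ω, δ, ∅, ∅⟩ : DiscreteDobrushin).IsInnerFace ![c - 1, j] ∧
              ¬ ((![c - 1, j + 1] : Site 2) ∈ (⟨Ω, δ, ∅, ∅⟩ : DiscreteDobrushin).zdBoundary ∧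
                (![c - 1 + 1, j + 1] : Site 2) ∈ (⟨Ω, δ, ∅, ∅⟩ : DiscreteDobrushin).zdBoundary))
            (fun j hj1 hj2 => ?_) ?_ hcl hX
          · obtain ⟨hi, hb⟩ := h3 j hj1 hj2
            refine ⟨hi, fun hb' => hb ⟨?_, hb'.1⟩⟩
            rw [show c - 1 + 1 = c by ring] at hb'; exact hb'.2
          · intro hce
            refine h4 ⟨hce.1, fun hb' => hce.2 ⟨hb'.2, ?_⟩⟩
            rw [show c - 1 + 1 = c by ring]; exact hb'.1
        subst hee
        rw [show c - 1 + 1 = c by ring] at hdegI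
        linarith [hdeg, hdegI]
      · intro k h1 h2
        rw [hGcenter, cellCenter_eq, cellCenter_eq]
        have hk1 : (-c : ℝ) ≤ k := by exact_mod_cast h1
        have hk2 : (k : ℝ) ≤ -c + 2 := by exact_mod_cast h2
        refine (dist_le_of_abs_le (a := δ) (b := 0) (abs_le.2 ⟨?_, ?_⟩) (abs_le.2 ⟨?_, ?_⟩)).trans (by linarith)
          <;> simp only <;> push_cast <;> nlinarith
      · intro z h1 h2 h3 h4
        have : G.symm z ∈ ball a η := by
          rw [hGsymm]
          refine hwin' (G z) (abs_le.2 ⟨?_, ?_⟩) (by rw [hGim]; linarith) (by rw [hGim]; exact h4)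
            <;> rw [hGre] <;> push_cast at h1 h2 <;> nlinarith [hc.1, hc.2]
        rw [mem_ball] at this ⊢
        rw [← G.symm.dist_map z (G a), LinearIsometryEquiv.symm_apply_apply]; exact this
    obtain ⟨hlift⟩ := nonempty_legData_of_image hδ hG hcor hunit hπ hL
    refine ⟨cellCenter δ (c - 2) R, ?_, ⟨hlift⟩⟩
    rw [cellCenter_eq]
    refine (dist_le_of_abs_le (a := (5 / 2) * δ) (b := δ / 2) (abs_le.2 ⟨?_, ?_⟩) (abs_le.2 ⟨?_, ?_⟩)).trans (by linarith)
      <;> simp only <;> push_cast <;> nlinarith [hc.1, hc.2, hR.1, hR.2]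
  · -- Case 1: not I-degenerate — the east leg in `Ω` itself
    refine ⟨cellCenter δ c R, ?_, legData_east (j₀ := c - 1) hΩ hJE hext hunb hδ hne hj₁R
      (fun k j h1 h2 h3 h4 => hdeepΩ k j (by omega) (by omega) h3 h4)
      (fun k h1 h2 => hbotΩ k (by omega) (by omega))
      (fun e₀ h1 h2 h3 h4 h5 hdeg => H ⟨e₀, ⟨h1, h2, h3, h4, h5⟩, hdeg⟩) (fun k h1 h2 => ?_) (fun z h1 h2 h3 h4 => ?_)⟩
    · rw [cellCenter_eq]
      refine (dist_le_of_abs_le (a := δ) (b := δ) (abs_le.2 ⟨?_, ?_⟩) (abs_le.2 ⟨?_, ?_⟩)).trans (by linarith)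
        <;> simp only <;> nlinarith [hc.1, hc.2, hR.1, hR.2]
    · rw [cellCenter_eq, cellCenter_eq]
      have hk1 : (c : ℝ) - 1 ≤ k := by exact_mod_cast h1
      have hk2 : (k : ℝ) ≤ c - 1 + 2 := by exact_mod_cast h2
      refine (dist_le_of_abs_le (a := δ) (b := 0) (abs_le.2 ⟨?_, ?_⟩) (abs_le.2 ⟨?_, ?_⟩)).trans (by linarith)
        <;> simp only <;> nlinarith
    · refine hwin' z (abs_le.2 ⟨?_, ?_⟩) (by linarith) h4 <;> push_cast at h1 h2 <;> nlinarith [hc.1, hc.2]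
  where
  /-- images of open sets under `G` are open -/
  isOpenMap_image (G : ℂ ≃ₗᵢ[ℝ] ℂ) : IsOpen (G '' Ω) := G.toHomeomorph.isOpenMap _ hΩ

end Summit.CriticalPhenomena.CardyFormulaZ2.Theorems.DiscretisationFamilyExists

end
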